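import Summits.CriticalPhenomena.PercolationContinuityZ3.Theorems.SahiMasterFamilyLemmaP

/-!
# Local trichotomy for terminal triples, I: no coordinate is mandatory for both its events (L2); no half-saturation (HS)

Companion of `SahiMasterFamilyLemmaP.lean` (unit `prim-master-conj`; terminal analysis of (T)).  For a coordinate `e`
shared by the essential supports of `A` and `B` (and not of `C`) in a terminal triple, the paper (STRUCTURE-PROOF.md
§4, verified VERIFICATION-gen3.md) classifies the local picture at `e`: `e` is MANDATORY for `X` if every member of `X`
contains `e` (`X_e = ∅`), and SATURATES `X` if the configuration `{e}` already lies in `X` (`X^e = univ`).  This file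
proves

* `lemma_L2` — **L2**: `e` is not mandatory for both `A` and `B` (the contraction at a coordinate `s ∈ esupp A ∩ esupp C`
  would have no realising pair);
* `lemma_HS` — **HS** (no private coordinate for `B`): if `e` is mandatory for neither, it does not saturate exactly
  one of `A, B` (the contraction forces `B^e ⟂ C`, the deletion forces `A_e ⟂ B_e`, whence `esupp B_e ⊆ esupp C` is
  disjoint from `esupp B^e`, and `∅ ≠ B_e ⊆ B^e` forces `B^e = univ`).
* `lemma_F1` — **(F1)** (paper §6): at a coordinate `e ∈ esupp X ∩ esupp Y` mandatory for `X`, the contraction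
  `(X^e, Y^e, Z) ∈ Z_3` is realised by `(X^e, Y^e)` (then `Y^e` ignores `esupp X ∖ e` and no coordinate of
  `esupp X ∩ esupp Z` is mandatory for `Z`) or by `(Y^e, Z)` (then `Y^e` ignores `esupp Z` and no coordinate of
  `esupp X ∩ esupp Z` is mandatory for `X`); `not_mandatory_of_zVia` is (O1).
Everything here is proved; axioms standard. [this work]
-/

noncomputable section

open scoped Classical

namespace Summit.CriticalPhenomena.PercolationContinuityZ3.Theorems

open Finset Function
open Literature.Probability.Percolation (DeterminedBy determinedBy_iff)
open Literature.Probability.LatticeModels.Kahn2022 (Affects)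

variable {ι : Type*} [Fintype ι]

/-! ### Sections: elementary facts -/

omit [Fintype ι] in
/-- The deletion is contained in the contraction (increasing events). [folklore] -/
theorem secAt_false_subset_true {A : Set (Set ι)} (hA : IsUpperSet A) (e : ι) : secAt e false A ⊆ secAt e true A := by
  intro ω hω
  rw [mem_secAt] at hω ⊢
  simp only [forceAt, cond_false, cond_true] at hω ⊢
  exact hA (Set.sdiff_subset.trans (Set.subset_insert e ω)) hω

/-- The full event has empty essential support. [folklore] -/
theorem esupp_univ : esupp (Set.univ : Set (Set ι)) = ∅ := by
  ext i; simp [mem_esupp, affects_iff]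

omit [Fintype ι] in
/-- `e` is mandatory for the increasing event `A` (`A_e = ∅`) iff `univ ∖ {e} ∉ A`. [folklore] -/
theorem secAt_false_eq_empty_iff {A : Set (Set ι)} (hA : IsUpperSet A) (e : ι) :
    secAt e false A = ∅ ↔ Set.univ \ {e} ∉ A := by
  constructor
  · intro h hmem
    have : Set.univ ∈ secAt e false A := by
      rw [mem_secAt]; simpa only [forceAt, cond_false] using hmem
    rw [h] at this; exact this
  · intro h
    ext ω
    simp only [Set.mem_empty_iff_false, iff_false]
    rw [mem_secAt]
    simp only [forceAt, cond_false]
    exact fun hω => h (hA (Set.sdiff_subset_sdiff_left (Set.subset_univ ω)) hω)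

omit [Fintype ι] in
/-- `e` saturates the increasing event `A` (`A^e = univ`) iff `{e} ∈ A`. [folklore] -/
theorem secAt_true_eq_univ_iff' {A : Set (Set ι)} (hA : IsUpperSet A) (e : ι) :
    secAt e true A = Set.univ ↔ ({e} : Set ι) ∈ A := by
  constructor
  · intro h
    have : (∅ : Set ι) ∈ secAt e true A := by rw [h]; exact Set.mem_univ _
    rw [mem_secAt] at this; simpa only [forceAt, cond_true, insert_empty_eq] using this
  · intro h
    ext ω
    simp only [Set.mem_univ, iff_true]
    rw [mem_secAt]
    simp only [forceAt, cond_true]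
    exact hA (Set.singleton_subset_iff.2 (Set.mem_insert e ω)) h

omit [Fintype ι] in
/-- A nonempty increasing event has `univ` in its contraction. [folklore] -/
theorem univ_mem_secAt_true {A : Set (Set ι)} (hA : IsUpperSet A) (hne : A.Nonempty) (e : ι) :
    Set.univ ∈ secAt e true A := by
  rw [mem_secAt]; simp only [forceAt, cond_true, Set.insert_eq_of_mem (Set.mem_univ e)]
  exact univ_mem_of_nonempty hA hne

omit [Fintype ι] in
/-- `univ ∖ {e}` lies in a nonempty increasing event not affected by `e`. [folklore] -/
theorem univ_diff_mem_of_not_affects {C : Set (Set ι)} (hC : IsUpperSet C) (hne : C.Nonempty) {e : ι}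
    (he : ¬ Affects C e) : Set.univ \ {e} ∈ C := by
  rw [← insert_mem_iff_of_not_affects hC he, Set.insert_sdiff_singleton, Set.insert_eq_of_mem (Set.mem_univ e)]
  exact univ_mem_of_nonempty hC hne

omit [Fintype ι] in
/-- Forcing `s` open keeps `univ ∖ {e}` (`s ≠ e`). [folklore] -/
theorem forceAt_true_univ_diff {s e : ι} (hse : s ≠ e) : forceAt s true (Set.univ \ {e}) = Set.univ \ {e} := by
  simp only [forceAt, cond_true]
  exact Set.insert_eq_of_mem ⟨Set.mem_univ s, hse⟩

omit [Fintype ι] in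
/-- `(univ ∖ {e}) ∪ {e} = univ`. [folklore] -/
theorem insert_univ_diff (e : ι) : insert e (Set.univ \ {e}) = (Set.univ : Set ι) := by
  rw [Set.insert_sdiff_singleton, Set.insert_eq_of_mem (Set.mem_univ e)]

/-- If `e` is mandatory for the nonempty increasing event `A` and `s ≠ e`, then `e` affects the contraction `A^s`.
[this work] -/
theorem affects_secAt_true_of_mandatory {A : Set (Set ι)} (hA : IsUpperSet A) (hne : A.Nonempty) {e s : ι}
    (hse : s ≠ e) (hmand : secAt e false A = ∅) : e ∈ esupp (secAt s true A) := by
  rw [mem_esupp]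
  refine ⟨Set.univ \ {e}, ?_, ?_⟩
  · rw [mem_secAt, forceAt_true_univ_diff hse]
    exact (secAt_false_eq_empty_iff hA e).1 hmand
  · rw [insert_univ_diff]
    exact univ_mem_secAt_true hA hne s

/-! ### L2: no coordinate is mandatory for both its events -/

/-- **L2.**  Let `A, B, C` be nonempty increasing events, `e` mandatory for both `A` and `B`, affecting `B` but not
`C`, and `s ≠ e` a coordinate not affecting `B`.  Then the contraction at `s`, `(A^s, B^s, C^s)`, is not in `Z_3`.
(In a terminal triple every contraction is in `Z_3`; taking `s ∈ esupp A ∩ esupp C` shows no shared coordinate is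
mandatory for both its events.) [this work] -/
theorem lemma_L2 {A B C : Set (Set ι)} (hA : IsUpperSet A) (hB : IsUpperSet B) (hC : IsUpperSet C)
    (hAne : A.Nonempty) (hBne : B.Nonempty) (hCne : C.Nonempty) {e s : ι} (hse : s ≠ e)
    (heB : e ∈ esupp B) (heC : e ∉ esupp C) (hsB : s ∉ esupp B)
    (hmA : secAt e false A = ∅) (hmB : secAt e false B = ∅) :
    ¬ SuppZeroFlag 3 ![secAt s true A, secAt s true B, secAt s true C] := by
  intro hZ
  have hA' : IsUpperSet (secAt s true A) := isUpperSet_secAt s true hA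
  have hC' : IsUpperSet (secAt s true C) := isUpperSet_secAt s true hC
  rw [secAt_eq_self_of_not_affects hB (fun h => hsB (mem_esupp.2 h)) true] at hZ
  have heA' : e ∈ esupp (secAt s true A) := affects_secAt_true_of_mandatory hA hAne hse hmA
  -- the configuration `univ ∖ {e}`: in `C^s`, not in `A^s`, not in `B`; adding `e` gives `univ`
  have hωC : Set.univ \ {e} ∈ secAt s true C := by
    rw [mem_secAt, forceAt_true_univ_diff hse]
    exact univ_diff_mem_of_not_affects hC hCne fun h => heC (mem_esupp.2 h)
  have hωA : Set.univ \ {e} ∉ secAt s true A := by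
    rw [mem_secAt, forceAt_true_univ_diff hse]; exact (secAt_false_eq_empty_iff hA e).1 hmA
  have hωB : Set.univ \ {e} ∉ B := (secAt_false_eq_empty_iff hB e).1 hmB
  rcases (suppZeroFlag_three_iff_zVia _ _ _).1 hZ with h | h | h
  · -- via (B, C^s), third A^s: side condition at `e ∈ esupp B` with ω = univ ∖ {e} ∈ C^s
    obtain ⟨-, -, h3⟩ := zVia_pivotal hB hC' hA' h
    refine h3 e heB _ hωC hωA ?_
    rw [insert_univ_diff]; exact univ_mem_secAt_true hA hAne s
  · -- via (A^s, C^s), third B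
    obtain ⟨-, -, h3⟩ := zVia_pivotal hA' hC' hB h
    refine h3 e heA' _ hωC hωB ?_
    rw [insert_univ_diff]; exact univ_mem_of_nonempty hB hBne
  · -- via (A^s, B): both depend on `e`
    obtain ⟨h1, -, -⟩ := zVia_pivotal hA' hB hC' h
    exact Finset.disjoint_left.1 h1 heA' heB

/-! ### HS: no half-saturation -/

/-- In `Z_3`, a triple with the trivial member `univ`: `(univ, Y, G) ∈ Z_3` forces `Y ⟂ G`. [this work] -/
theorem disjoint_of_suppZeroFlag_three_univ {Y G : Set (Set ι)} (hY : IsUpperSet Y) (hG : IsUpperSet G)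
    (h : SuppZeroFlag 3 ![Set.univ, Y, G]) : Disjoint (esupp Y) (esupp G) := by
  have hU : IsUpperSet (Set.univ : Set (Set ι)) := isUpperSet_univ
  rcases (suppZeroFlag_three_iff_zVia _ _ _).1 h with h | h | h
  · exact (zVia_pivotal hY hG hU h).1
  · obtain ⟨-, h2, -⟩ := h
    rw [Set.univ_inter] at h2
    exact (suppZeroFlag_two_iff hY hG).1 h2
  · obtain ⟨-, h2, -⟩ := h
    rw [Set.univ_inter] at h2
    exact disjoint_comm.1 ((suppZeroFlag_two_iff hG hY).1 h2)

/-- If `e` saturates `A` then the deletion `A_e` carries all the other essential coordinates of `A`. [this work] -/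
theorem erase_subset_esupp_secAt_false {A : Set (Set ι)} {e : ι} (hsat : secAt e true A = Set.univ) :
    (esupp A).erase e ⊆ esupp (secAt e false A) := by
  intro f hf
  rw [mem_erase] at hf
  rcases mem_esupp_secAt_or hf.2 hf.1 with h | h
  · exact h
  · rw [hsat, esupp_univ] at h; exact absurd h (Finset.notMem_empty f)

/-- **HS.**  Let `A, B, C` be increasing with `esupp A ∩ esupp C ≠ ∅ ≠ esupp B ∩ esupp C`, `B` without private
coordinates (`esupp B ⊆ esupp A ∪ esupp C`), and `e ∈ esupp A` not affecting `C`.  If `B_e ≠ ∅` (e not mandatory for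
`B`), `e` saturates `A` but not `B`, then the contraction and the deletion at `e` are not both in `Z_3`. [this work] -/
theorem lemma_HS {A B C : Set (Set ι)} (hA : IsUpperSet A) (hB : IsUpperSet B) (hC : IsUpperSet C)
    (hAC : (esupp A ∩ esupp C).Nonempty) (hBC : (esupp B ∩ esupp C).Nonempty)
    (hnoprivB : esupp B ⊆ esupp A ∪ esupp C) {e : ι} (heC : e ∉ esupp C)
    (hB0 : (secAt e false B).Nonempty) (hsatA : secAt e true A = Set.univ) (hnsatB : secAt e true B ≠ Set.univ)
    (hK : SuppZeroFlag 3 ![secAt e true A, secAt e true B, secAt e true C])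
    (hD : SuppZeroFlag 3 ![secAt e false A, secAt e false B, secAt e false C]) : False := by
  have hCe : ∀ b, secAt e b C = C := fun b => secAt_eq_self_of_not_affects hC (fun h => heC (mem_esupp.2 h)) b
  rw [hsatA, hCe] at hK
  rw [hCe] at hD
  have hB1 : IsUpperSet (secAt e true B) := isUpperSet_secAt e true hB
  have hB0u : IsUpperSet (secAt e false B) := isUpperSet_secAt e false hB
  have hA0u : IsUpperSet (secAt e false A) := isUpperSet_secAt e false hA
  -- (K): `B^e ⟂ C`
  have dB1C : Disjoint (esupp (secAt e true B)) (esupp C) := disjoint_of_suppZeroFlag_three_univ hB1 hC hK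
  -- hence `esupp B ∩ esupp C ⊆ esupp B_e`
  have hBC0 : ∀ t ∈ esupp B ∩ esupp C, t ∈ esupp (secAt e false B) := by
    intro t ht
    have htC := (mem_inter.1 ht).2
    rcases mem_esupp_secAt_or (mem_inter.1 ht).1 (fun hte : t = e => heC (hte ▸ htC)) with h | h
    · exact h
    · exact absurd htC (Finset.disjoint_left.1 dB1C h)
  -- `esupp A_e ⊇ esupp A ∖ e`
  have hA0 : (esupp A).erase e ⊆ esupp (secAt e false A) := erase_subset_esupp_secAt_false hsatA
  -- (D): only the pair (A_e, B_e) can realise it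
  have dA0B0 : Disjoint (esupp (secAt e false A)) (esupp (secAt e false B)) := by
    rcases (suppZeroFlag_three_iff_zVia _ _ _).1 hD with h | h | h
    · -- via (B_e, C): they share `esupp B ∩ esupp C`
      obtain ⟨t, ht⟩ := hBC
      exact absurd (zVia_pivotal hB0u hC hA0u h).1 (Finset.not_disjoint_iff.2 ⟨t, hBC0 t ht, (mem_inter.1 ht).2⟩)
    · -- via (A_e, C): they share `esupp A ∩ esupp C`
      obtain ⟨s, hs⟩ := hAC
      have hsC := (mem_inter.1 hs).2
      have hse : s ≠ e := fun hse => heC (hse ▸ hsC)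
      exact absurd (zVia_pivotal hA0u hC hB0u h).1
        (Finset.not_disjoint_iff.2 ⟨s, hA0 (mem_erase.2 ⟨hse, (mem_inter.1 hs).1⟩), hsC⟩)
    · exact (zVia_pivotal hA0u hB0u hC h).1
  -- so `esupp B_e ⊆ esupp C`
  have hB0C : esupp (secAt e false B) ⊆ esupp C := by
    intro t ht
    have ht' := esupp_secAt_subset hB e false ht
    rw [mem_erase] at ht'
    rcases mem_union.1 (hnoprivB ht'.2) with htA | htC
    · exact absurd ht (Finset.disjoint_left.1 dA0B0 (hA0 (mem_erase.2 ⟨ht'.1, htA⟩)))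
    · exact htC
  -- `esupp B_e` and `esupp B^e` are disjoint; `∅ ≠ B_e ⊆ B^e` forces `B^e = univ`
  have d01 : Disjoint (esupp (secAt e false B)) (esupp (secAt e true B)) :=
    Finset.disjoint_of_subset_left hB0C (disjoint_comm.1 dB1C)
  apply hnsatB
  have hωB0 : (↑(esupp (secAt e false B)) : Set ι) ∈ secAt e false B := by
    refine (mem_iff_of_inter_esupp_eq hB0u (ω' := Set.univ) ?_).2 (univ_mem_of_nonempty hB0u hB0)
    simp
  have hωB1 : (↑(esupp (secAt e false B)) : Set ι) ∈ secAt e true B := secAt_false_subset_true hB e hωB0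
  have hempty : (∅ : Set ι) ∈ secAt e true B := by
    refine (mem_iff_of_inter_esupp_eq hB1 (ω := ∅) (ω' := ↑(esupp (secAt e false B))) ?_).2 hωB1
    ext i
    simp only [Set.empty_inter, Set.mem_empty_iff_false, Set.mem_inter_iff, mem_coe, false_iff, not_and]
    exact fun h0 h1 => Finset.disjoint_left.1 d01 h0 h1
  exact Set.eq_univ_of_forall fun ω => hB1 (Set.empty_subset ω) hempty

/-! ### NS (first half): a saturating coordinate saturates both events and is mandatory for neither -/

/-- If `e` saturates `A` and is mandatory for `A` then `A = [e]` has essential support `{e}`: impossible when another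
coordinate affects `A`. [this work] -/
theorem not_mandatory_of_saturates {A : Set (Set ι)} (hA : IsUpperSet A) {e s : ι} (hse : s ≠ e) (hs : s ∈ esupp A)
    (hsat : secAt e true A = Set.univ) (hmand : secAt e false A = ∅) : False := by
  have hin : ∀ ω : Set ι, e ∈ ω → ω ∈ A := fun ω he =>
    hA (Set.singleton_subset_iff.2 he) ((secAt_true_eq_univ_iff' hA e).1 hsat)
  have hout : ∀ ω : Set ι, ω ∈ A → e ∈ ω := by
    intro ω hω
    by_contra heω
    have : ω ∈ secAt e false A := by
      rw [mem_secAt]; simp only [forceAt, cond_false]; rwa [Set.sdiff_singleton_eq_self heω]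
    rw [hmand] at this; exact this
  obtain ⟨ω, hω, hsω⟩ := mem_esupp.1 hs
  rcases Set.mem_insert_iff.1 (hout _ hsω) with h | h
  · exact hse h.symm
  · exact hω (hin ω h)

/-- **NS, first half.**  In a triple of increasing events with pairwise-intersecting essential supports, no private
coordinate for `B`, `e ∈ esupp A ∩ esupp B` not affecting `C`, and both `e`-minors in `Z_3`: if `e` saturates `A`,
then `e` saturates `B` as well and is mandatory for neither (the hypotheses of SS).  [this work] -/
theorem saturates_both_of_saturates {A B C : Set (Set ι)} (hA : IsUpperSet A) (hB : IsUpperSet B) (hC : IsUpperSet C)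
    (hAC : (esupp A ∩ esupp C).Nonempty) (hBC : (esupp B ∩ esupp C).Nonempty)
    (hnoprivB : esupp B ⊆ esupp A ∪ esupp C) {e : ι} (heC : e ∉ esupp C)
    (hsatA : secAt e true A = Set.univ)
    (hK : SuppZeroFlag 3 ![secAt e true A, secAt e true B, secAt e true C])
    (hD : SuppZeroFlag 3 ![secAt e false A, secAt e false B, secAt e false C]) :
    (secAt e false A).Nonempty ∧ (secAt e false B).Nonempty ∧ secAt e true B = Set.univ := by
  -- `e` is not mandatory for `A`
  have hA0 : (secAt e false A).Nonempty := by
    rw [Set.nonempty_iff_ne_empty]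
    intro hmand
    obtain ⟨s, hs⟩ := hAC
    exact not_mandatory_of_saturates hA (fun hse : s = e => heC (hse ▸ (mem_inter.1 hs).2)) (mem_inter.1 hs).1
      hsatA hmand
  -- `e` is not mandatory for `B`: else `(univ, B^e, C) ∈ Z_3` makes `B^e ⟂ C`, but `B^e` carries `esupp B ∩ esupp C`
  have hB0 : (secAt e false B).Nonempty := by
    rw [Set.nonempty_iff_ne_empty]
    intro hmand
    have hCe : ∀ b, secAt e b C = C := fun b => secAt_eq_self_of_not_affects hC (fun h => heC (mem_esupp.2 h)) b
    rw [hsatA, hCe] at hK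
    have d := disjoint_of_suppZeroFlag_three_univ (isUpperSet_secAt e true hB) hC hK
    obtain ⟨t, ht⟩ := hBC
    have htC := (mem_inter.1 ht).2
    rcases mem_esupp_secAt_or (mem_inter.1 ht).1 (fun hte : t = e => heC (hte ▸ htC)) with h | h
    · rw [hmand, esupp_empty] at h; exact Finset.notMem_empty t h
    · exact Finset.disjoint_left.1 d h htC
  refine ⟨hA0, hB0, ?_⟩
  by_contra hnsat
  exact lemma_HS hA hB hC hAC hBC hnoprivB heC hB0 hsatA hnsat hK hD

/-! ### Rule (F1) at a mandatory coordinate -/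


/-- If `e` is mandatory for `X` (`X_e = ∅`), the contraction carries all other essential coordinates:
`esupp X^e = esupp X ∖ {e}`. [this work] -/
theorem esupp_secAt_true_of_mandatory {X : Set (Set ι)} (hX : IsUpperSet X) {e : ι} (hmand : secAt e false X = ∅) :
    esupp (secAt e true X) = (esupp X).erase e := by
  refine Finset.Subset.antisymm (esupp_secAt_subset hX e true) fun f hf => ?_
  rw [mem_erase] at hf
  rcases mem_esupp_secAt_or hf.2 hf.1 with h | h
  · rw [hmand, esupp_empty] at h; exact absurd h (Finset.notMem_empty f)
  · exact h

/-- (O1): if `(P, Q, G) ∈ Z_3` via `(P, Q)` with `Q` nonempty, then no coordinate `s ∈ esupp P` that does not affect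
`Q` is mandatory for `G`. [this work] -/
theorem not_mandatory_of_zVia {P Q G : Set (Set ι)} (hP : IsUpperSet P) (hQ : IsUpperSet Q) (hG : IsUpperSet G)
    (hGne : G.Nonempty) (hQne : Q.Nonempty) (h : ZVia P Q G) {s : ι} (hsP : s ∈ esupp P) (hsQ : s ∉ esupp Q) :
    (secAt s false G).Nonempty := by
  rw [Set.nonempty_iff_ne_empty]
  intro hmand
  obtain ⟨-, -, p2⟩ := zVia_pivotal hP hQ hG h
  refine p2 s hsP (Set.univ \ {s}) (univ_diff_mem_of_not_affects hQ hQne fun h' => hsQ (mem_esupp.2 h'))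
    ((secAt_false_eq_empty_iff hG s).1 hmand) ?_
  rw [insert_univ_diff]; exact univ_mem_of_nonempty hG hGne

/-- **(F1).**  `X, Y, Z` increasing and nonempty, `e ∈ esupp X ∩ esupp Y` not affecting `Z` and MANDATORY for `X`,
no coordinate of `esupp X ∩ esupp Z` affecting `Y`, and `esupp X ∩ esupp Z ≠ ∅`.  If the contraction `(X^e, Y^e, Z)`
is in `Z_3`, then either `Y^e` ignores `esupp X ∖ {e}` and no coordinate of `esupp X ∩ esupp Z` is mandatory for `Z`,
or `Y^e` ignores `esupp Z` and no coordinate of `esupp X ∩ esupp Z` is mandatory for `X`. [this work] -/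
theorem lemma_F1 {X Y Z : Set (Set ι)} (hX : IsUpperSet X) (hY : IsUpperSet Y) (hZ : IsUpperSet Z)
    (hXne : X.Nonempty) (hYne : Y.Nonempty) (hZne : Z.Nonempty)
    (hXZ : (esupp X ∩ esupp Z).Nonempty) (hnocommon : ∀ s ∈ esupp X ∩ esupp Z, s ∉ esupp Y)
    {e : ι} (heZ : e ∉ esupp Z) (hmand : secAt e false X = ∅)
    (hK : SuppZeroFlag 3 ![secAt e true X, secAt e true Y, secAt e true Z]) :
    (Disjoint (esupp (secAt e true Y)) ((esupp X).erase e) ∧ ∀ s ∈ esupp X ∩ esupp Z, (secAt s false Z).Nonempty) ∨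
    (Disjoint (esupp (secAt e true Y)) (esupp Z) ∧ ∀ t ∈ esupp X ∩ esupp Z, (secAt t false X).Nonempty) := by
  have hX1 : IsUpperSet (secAt e true X) := isUpperSet_secAt e true hX
  have hY1 : IsUpperSet (secAt e true Y) := isUpperSet_secAt e true hY
  have hY1ne : (secAt e true Y).Nonempty := ⟨Set.univ, univ_mem_secAt_true hY hYne e⟩
  have hX1ne : (secAt e true X).Nonempty := ⟨Set.univ, univ_mem_secAt_true hX hXne e⟩
  rw [secAt_eq_self_of_not_affects hZ (fun h => heZ (mem_esupp.2 h)) true] at hK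
  have esX1 : esupp (secAt e true X) = (esupp X).erase e := esupp_secAt_true_of_mandatory hX hmand
  have hIXZ1 : ∀ s ∈ esupp X ∩ esupp Z, s ∈ esupp (secAt e true X) := by
    intro s hs
    rw [esX1, mem_erase]
    exact ⟨fun hse => heZ (hse ▸ (mem_inter.1 hs).2), (mem_inter.1 hs).1⟩
  rcases (suppZeroFlag_three_iff_zVia _ _ _).1 hK with h | h | h
  · -- via (Y^e, Z), third X^e
    right
    refine ⟨(zVia_pivotal hY1 hZ hX1 h).1, fun t ht => ?_⟩
    -- `t` mandatory for `X` would make `univ ∖ {t}` a forbidden `t`-pivotal configuration for `X^e`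
    have htY1 : t ∉ esupp (secAt e true Y) := fun h' =>
      hnocommon t ht (mem_of_subset (erase_subset _ _) (esupp_secAt_subset hY e true h'))
    have hne := not_mandatory_of_zVia hZ hY1 hX1 hX1ne hY1ne ((zVia_comm hY1 hZ hX1).1 h) (mem_inter.1 ht).2 htY1
    -- `(X^e)_t ≠ ∅` gives `X_t ≠ ∅`
    rw [Set.nonempty_iff_ne_empty, Ne, secAt_false_eq_empty_iff hX1 t] at hne
    rw [Set.nonempty_iff_ne_empty, Ne, secAt_false_eq_empty_iff hX t]
    intro hout; apply hne; intro hin; apply hout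
    rw [mem_secAt] at hin
    simp only [forceAt, cond_true] at hin
    have hte : t ≠ e := fun hte => heZ (hte ▸ (mem_inter.1 ht).2)
    -- `insert e (univ ∖ {t}) = univ ∖ {t}`
    rwa [Set.insert_eq_of_mem (show e ∈ Set.univ \ {t} from ⟨Set.mem_univ e, fun h : e ∈ ({t} : Set ι) => hte (Set.mem_singleton_iff.1 h).symm⟩)] at hin
  · -- via (X^e, Z): impossible, they share `esupp X ∩ esupp Z`
    exfalso
    obtain ⟨s, hs⟩ := hXZ
    exact Finset.disjoint_left.1 (zVia_pivotal hX1 hZ hY1 h).1 (hIXZ1 s hs) (mem_inter.1 hs).2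
  · -- via (X^e, Y^e), third Z
    left
    refine ⟨disjoint_comm.1 (esX1 ▸ (zVia_pivotal hX1 hY1 hZ h).1), fun s hs => ?_⟩
    have hsY1 : s ∉ esupp (secAt e true Y) := fun h' =>
      hnocommon s hs (mem_of_subset (erase_subset _ _) (esupp_secAt_subset hY e true h'))
    exact not_mandatory_of_zVia hX1 hY1 hZ hZne hY1ne h (hIXZ1 s hs) hsY1


end Summit.CriticalPhenomena.PercolationContinuityZ3.Theorems
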